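import Summits.AtomisticToContinuum.Crystallization.Theorems.UniformPolytypeStability.Negative.Mirror
import Summits.AtomisticToContinuum.Crystallization.Theorems.UniformPolytypeStability.Negative.Membrane

/-!
# `UniformPolytypeStability` (stmt-AtomisticToContinuum-15800), negative side V-a: the AAA lattice and its exact near field

Part V-a of the standing disprover's load-bearing analysis of crux `UniformPolytypeStability`
(route `DisclinationRation`): the Hägg condition `IsHaggSeq s` is LOAD-BEARING (part V-b,
`Negative/WithoutHagg.lean`).  The witness is the ZERO word `s ≡ 0` (`haggLabel ≡ 0`: every layer
in registry `A`, the simple-hexagonal AAA stacking — excluded by `IsHaggSeq`, whose letters are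
`±1`) at `a₀ = 47/50` with uniform heights `h₀ = 39a₀/50 = 0.7332 < 1`: its vertical bonds are
strongly compressed.  This file: the site set is the Bravais lattice `ℤu + ℤv + ℤh₀e₃`
(`sites_zero_zU`, so part I gives force balance and part II the row formula), its labels `Y₀`,
the row function `e₁ᵀK(x)e₁ = T(x₁², |x|²)` as a rational function (`Hess₀_ex₁_eq`), the one-sided
far bound `T ≤ q⁻⁴` (`TQ_le`), and the EXACT near field over `ℚ`, evaluated by the kernel
(`near_sum_lt`: `Σ_{0<|n|_∞≤2} T = −75.86… < −75.8`; `decide +kernel`, standard axioms).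
All `[folklore]`.
-/

noncomputable section

namespace Summit.AtomisticToContinuum.Crystallization.Theorems.UniformPolytypeStabilityNegative

open scoped BigOperators Topology Classical InnerProductSpace
open Filter Set Function Real
open Literature.MathematicalPhysics.StatisticalMechanics
open Summit.AtomisticToContinuum.Crystallization.Theorems.PhononStabilityNegative

local notation "E3" => EuclideanSpace ℝ (Fin 3)

/-! ## §8 The simple-hexagonal (AAA) stacking: the Hägg condition `IsHaggSeq s` is load-bearing -/

section Hagg

/-- The zero word labels every layer `A`: `haggLabel 0 ≡ 0`. [folklore] -/
@[simp] theorem haggLabel_zero_fun (m : ℤ) : haggLabel (0 : ℤ → ℤ) m = 0 := by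
  simp [haggLabel, haggWindow]

/-- The simple-hexagonal Bravais lattice `ℤu_a + ℤv_a + ℤ(h e₃)` (the tree's Barlow period
lattice of the ZERO word, period `1`). [folklore] -/
def shLat {a h : ℝ} (ha : a ≠ 0) (hh : h ≠ 0) : Submodule ℤ E3 :=
  barlowPeriodLattice 0 ha hh one_ne_zero

/-- The simple-hexagonal lattice is discrete. [folklore] -/
instance {a h : ℝ} (ha : a ≠ 0) (hh : h ≠ 0) : DiscreteTopology (shLat ha hh) := by
  unfold shLat barlowPeriodLattice; infer_instance

/-- The simple-hexagonal lattice is a full lattice. [folklore] -/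
instance {a h : ℝ} (ha : a ≠ 0) (hh : h ≠ 0) : IsZLattice ℝ (shLat ha hh) := by
  unfold shLat barlowPeriodLattice; infer_instance

/-- `rank shLat = 3`. [folklore] -/
theorem finrank_shLat {a h : ℝ} (ha : a ≠ 0) (hh : h ≠ 0) :
    Module.finrank ℤ (shLat ha hh) = 3 := by
  rw [ZLattice.rank ℝ (shLat ha hh), finrank_euclideanSpace, Fintype.card_fin]

/-- Membership in the simple-hexagonal lattice: `i u + j v + m h e₃`. [folklore] -/
theorem mem_shLat_iff {a h : ℝ} (ha : a ≠ 0) (hh : h ≠ 0) (g : E3) :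
    g ∈ shLat ha hh ↔ ∃ m i j : ℤ, g = (i : ℝ) • triangularVec₁ a + (j : ℝ) • triangularVec₂ a +
      (m : ℝ) • layerNormal h := by
  have key : ∀ m : ℤ, (m : ℝ) • ((haggWindow (0 : ℤ → ℤ) 0 1 : ℝ) • barlowOffset a +
      ((1 : ℕ) : ℝ) • layerNormal h) = (m : ℝ) • layerNormal h := by
    intro m; simp [haggWindow]
  constructor
  · intro hg
    obtain ⟨n₀, n₁, n₂, rfl⟩ :=
      exists_eq_of_mem_barlowPeriodLattice (0 : ℤ → ℤ) ha hh one_ne_zero hg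
    exact ⟨n₂, n₀, n₁, by rw [key]⟩
  · rintro ⟨m, i, j, rfl⟩
    have := sum_smul_mem_barlowPeriodLattice (0 : ℤ → ℤ) ha hh one_ne_zero i j m
    rwa [key] at this

/-- **For the zero word and uniform heights the site set is the simple-hexagonal lattice**
(AAA stacking). [folklore] -/
theorem sites_zero_zU {a h : ℝ} (ha : a ≠ 0) (hh : h ≠ 0) :
    Sites a 0 (zU h) = (shLat ha hh : Set E3) := by
  ext g
  rw [SetLike.mem_coe, mem_shLat_iff]
  simp only [Sites, Set.mem_setOf_eq, haggLabel_zero_fun, Int.cast_zero, zero_smul, add_zero, zU]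
  constructor
  · rintro ⟨m, i, j, rfl⟩
    exact ⟨m, i, j, by rw [smul_layerNormal, smul_layerNormal, mul_one, mul_comm]⟩
  · rintro ⟨m, i, j, rfl⟩
    exact ⟨m, i, j, by rw [smul_layerNormal, smul_layerNormal, mul_one, mul_comm]⟩

/-- Lattice vectors are points of the AAA stacking. [folklore] -/
theorem mem_stacking_of_mem_shLat {a h : ℝ} (ha : a ≠ 0) (hh : h ≠ 0) {g : E3}
    (hg : g ∈ shLat ha hh) : g ∈ barlowStacking a h 0 := by
  obtain ⟨m, i, j, rfl⟩ := (mem_shLat_iff ha hh g).1 hg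
  exact ⟨m, i, j, by simp [barlowPos]⟩

/-- Nonzero vectors of the AAA lattice are long: `‖g‖ ≥ min a h`. [folklore] -/
theorem min_le_norm_of_mem_shLat {a h : ℝ} (ha : 0 < a) (hh : 0 < h) {g : E3}
    (hg : g ∈ shLat ha.ne' hh.ne') (hg0 : g ≠ 0) : min a h ≤ ‖g‖ := by
  have h0 : (0 : E3) ∈ barlowStacking a h 0 := ⟨0, 0, 0, by simp [barlowPos]⟩
  have := le_dist_of_mem_barlowStacking a h 0 ha.le hh.le h0
    (mem_stacking_of_mem_shLat ha.ne' hh.ne' hg) hg0.symm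
  rwa [dist_eq_norm, zero_sub, norm_neg] at this

/-! ### The witness lattice: `a = a₀ = 47/50`, `h = h₀ = 39a₀/50` -/

/-- The lower edge of the height window at `a₀`: `h₀ = 39a₀/50 = 0.7332`. [folklore] -/
def h₀ : ℝ := 39 / 50 * a₀

/-- Labels of the AAA lattice: `Y₀(i,j,m) = i u + j v + m h₀ e₃`. [folklore] -/
def Y₀ (n : ℤ × ℤ × ℤ) : E3 := barlowPos a₀ h₀ 0 n.2.2 n.1 n.2.1

/-- First coordinate. [folklore] -/
theorem Y₀_apply_zero (n : ℤ × ℤ × ℤ) : Y₀ n 0 = a₀ * (n.1 + n.2.1 / 2) := by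
  simp [Y₀]

/-- Second coordinate. [folklore] -/
theorem Y₀_apply_one (n : ℤ × ℤ × ℤ) : Y₀ n 1 = a₀ * √3 / 2 * n.2.1 := by
  simp [Y₀]

/-- Third coordinate. [folklore] -/
theorem Y₀_apply_two (n : ℤ × ℤ × ℤ) : Y₀ n 2 = n.2.2 * h₀ := by
  simp [Y₀]

/-- `Y₀ 0 = 0`. [folklore] -/
theorem Y₀_zero : Y₀ 0 = 0 := by
  simp [Y₀, barlowPos]

/-- `a₀ ≠ 0`, `h₀ ≠ 0`. [folklore] -/
theorem a₀_ne_zero' : a₀ ≠ 0 ∧ h₀ ≠ 0 := by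
  unfold h₀ a₀; norm_num

/-- `Y₀(n)` is a lattice vector. [folklore] -/
theorem Y₀_mem (n : ℤ × ℤ × ℤ) : Y₀ n ∈ shLat a₀_ne_zero'.1 a₀_ne_zero'.2 :=
  (mem_shLat_iff _ _ _).2 ⟨n.2.2, n.1, n.2.1, by simp [Y₀, barlowPos]⟩

/-- Every lattice vector is labelled. [folklore] -/
theorem exists_Y₀_eq {g : E3} (hg : g ∈ shLat a₀_ne_zero'.1 a₀_ne_zero'.2) : ∃ n, Y₀ n = g := by
  obtain ⟨m, i, j, rfl⟩ := (mem_shLat_iff _ _ g).1 hg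
  exact ⟨(i, j, m), by simp [Y₀, barlowPos]⟩

/-- Labels are unique. [folklore] -/
theorem Y₀_injective : Function.Injective Y₀ := by
  rintro ⟨i, j, m⟩ ⟨i', j', m'⟩ h
  have h2 := congrArg (fun x : E3 => x 2) h
  have h1 := congrArg (fun x : E3 => x 1) h
  have h0 := congrArg (fun x : E3 => x 0) h
  simp only [Y₀_apply_two, Y₀_apply_one, Y₀_apply_zero] at h0 h1 h2
  have ha : (0 : ℝ) < a₀ := by unfold a₀; norm_num
  have hh : h₀ ≠ 0 := a₀_ne_zero'.2
  have h3 : (0 : ℝ) < √3 := Real.sqrt_pos.2 (by norm_num)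
  have hm : (m : ℝ) = m' := mul_right_cancel₀ hh h2
  have hj : (j : ℝ) = j' := mul_left_cancel₀ (show a₀ * √3 / 2 ≠ 0 by positivity) h1
  have hi : (i : ℝ) = i' := by
    have := mul_left_cancel₀ ha.ne' h0
    linarith
  have hm' : m = m' := by exact_mod_cast hm
  have hj' : j = j' := by exact_mod_cast hj
  have hi' : i = i' := by exact_mod_cast hi
  rw [hm', hj', hi']

/-- `‖Y₀(i,j,m)‖² = a₀²(i² + ij + j²) + m²h₀²`. [folklore] -/
theorem norm_sq_Y₀ (n : ℤ × ℤ × ℤ) :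
    ‖Y₀ n‖ ^ 2 = a₀ ^ 2 * (Qf (n.1, n.2.1) : ℝ) + (n.2.2 : ℝ) ^ 2 * h₀ ^ 2 := by
  have h3 : (√3 : ℝ) ^ 2 = 3 := Real.sq_sqrt (by norm_num)
  rw [EuclideanSpace.norm_sq_eq, Fin.sum_univ_three, Y₀_apply_zero, Y₀_apply_one, Y₀_apply_two]
  simp only [Real.norm_eq_abs, sq_abs, Qf]
  push_cast
  linear_combination (a₀ ^ 2 * (n.2.1 : ℝ) ^ 2 / 4) * h3

/-- Nonzero labelled vectors are at least `1/2` long (`min a₀ h₀ = h₀ = 0.7332`). [folklore] -/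
theorem half_le_norm_Y₀ {n : ℤ × ℤ × ℤ} (hn : Y₀ n ≠ 0) : (1 / 2 : ℝ) ≤ ‖Y₀ n‖ := by
  have ha : (0 : ℝ) < a₀ := by unfold a₀; norm_num
  have hh : (0 : ℝ) < h₀ := by unfold h₀ a₀; norm_num
  have h := min_le_norm_of_mem_shLat ha hh (Y₀_mem n) hn
  have : (1 / 2 : ℝ) ≤ min a₀ h₀ := le_min (by unfold a₀; norm_num) (by unfold h₀ a₀; norm_num)
  linarith

/-! ### The row function of `e₁·𝟙_{0}` as a rational function of `(x₁², |x|²)` -/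

/-- The in-plane unit vector `e₁`. [folklore] -/
def ex₁ : E3 := EuclideanSpace.single 0 (1 : ℝ)

/-- `‖e₁‖ = 1`. [folklore] -/
theorem norm_ex₁ : ‖ex₁‖ = 1 := by
  rw [ex₁, PiLp.norm_single, norm_one]

/-- `⟪x, e₁⟫ = x₁`. [folklore] -/
theorem inner_ex₁ (x : E3) : inner ℝ x ex₁ = x 0 := by
  rw [ex₁, EuclideanSpace.inner_single_right]; simp

/-- `e₁ᵀK(x)e₁ = V″(r)c² + (V′(r)/r)(1 − c²)` written in `p = x₁²`, `q = r²` (`c² = p/q`):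
`T(p,q) = (13q⁻⁷ − 7q⁻⁴)(p/q) + (−q⁻⁷ + q⁻⁴)(1 − p/q)`. [folklore] -/
def TQ (p q : ℝ) : ℝ :=
  (13 * (q⁻¹) ^ 7 - 7 * (q⁻¹) ^ 4) * (p / q) + (-(q⁻¹) ^ 7 + (q⁻¹) ^ 4) * (1 - p / q)

/-- The same rational function over `ℚ` (for kernel evaluation of the near field). [folklore] -/
def TQq (p q : ℚ) : ℚ :=
  (13 * (q⁻¹) ^ 7 - 7 * (q⁻¹) ^ 4) * (p / q) + (-(q⁻¹) ^ 7 + (q⁻¹) ^ 4) * (1 - p / q)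

/-- `T` over `ℚ` casts to `T` over `ℝ`. [folklore] -/
theorem cast_TQq (p q : ℚ) : ((TQq p q : ℚ) : ℝ) = TQ p q := by
  unfold TQq TQ; push_cast; ring

/-- `e₁ᵀK(x)e₁ = T(x₁², |x|²)` for `x ≠ 0`. [folklore] -/
theorem Hess₀_ex₁_eq {x : E3} (hx : x ≠ 0) : Hess₀ x ex₁ = TQ ((x 0) ^ 2) (‖x‖ ^ 2) := by
  have hr : ‖x‖ ≠ 0 := norm_ne_zero_iff.2 hx
  unfold Hess₀ TQ
  rw [deriv_deriv_lennardJones hr, deriv_lennardJones hr, inner_ex₁, norm_ex₁]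
  field_simp

/-- One-sided far-field bound: for `0 ≤ p ≤ q` and `q ≥ 4` (so `13q⁻⁷ ≤ q⁻⁴`), `T(p,q) ≤ q⁻⁴`.
[folklore] -/
theorem TQ_le {p q : ℝ} (hp0 : 0 ≤ p) (hpq : p ≤ q) (h4 : 4 ≤ q) : TQ p q ≤ (q⁻¹) ^ 4 := by
  have hq : 0 < q := by linarith
  have h13 : 13 ≤ q ^ 3 := by
    have h16 : 16 ≤ q ^ 2 := by nlinarith
    nlinarith [mul_nonneg (sub_nonneg.2 h4) (sq_nonneg q)]
  set A : ℝ := (q⁻¹) ^ 7 with hA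
  set B : ℝ := (q⁻¹) ^ 4 with hB
  set t : ℝ := p / q with ht
  have hA0 : 0 ≤ A := by positivity
  have hB0 : 0 ≤ B := by positivity
  have ht0 : 0 ≤ t := by positivity
  have ht1 : t ≤ 1 := (div_le_one hq).2 hpq
  have hAB : 13 * A ≤ B := by
    have hq0 : q ≠ 0 := hq.ne'
    have e : B = A * q ^ 3 := by rw [hA, hB]; field_simp
    rw [e]; nlinarith
  have h1 : 13 * A * t ≤ B * t := mul_le_mul_of_nonneg_right hAB ht0
  have h2 : 0 ≤ B * t := mul_nonneg hB0 ht0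
  have h3 : 0 ≤ A * (1 - t) := mul_nonneg hA0 (by linarith)
  have e : TQ p q = (13 * A - 7 * B) * t + (-A + B) * (1 - t) := rfl
  rw [e]; nlinarith

/-! ### The near field: `|n|_∞ ≤ 2` evaluated exactly over `ℚ` -/

/-- `a₀²` and `h₀²` over `ℚ`. [folklore] -/
def a2q : ℚ := (47 / 50) ^ 2

/-- `h₀²` over `ℚ`. [folklore] -/
def h2q : ℚ := (39 / 50) ^ 2 * a2q

/-- `x₁²` of the label `n` over `ℚ`. [folklore] -/
def pOf (n : ℤ × ℤ × ℤ) : ℚ := a2q * ((2 * n.1 + n.2.1 : ℚ) / 2) ^ 2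

/-- `|x|²` of the label `n` over `ℚ`. [folklore] -/
def qOf (n : ℤ × ℤ × ℤ) : ℚ := a2q * (n.1 ^ 2 + n.1 * n.2.1 + n.2.1 ^ 2 : ℚ) + (n.2.2 : ℚ) ^ 2 * h2q

/-- The near block `{|i|,|j|,|m| ≤ 2} ∖ {0}` (124 labels). [folklore] -/
def blockFin : Finset (ℤ × ℤ × ℤ) :=
  (Finset.Icc (-2 : ℤ) 2 ×ˢ Finset.Icc (-2 : ℤ) 2 ×ˢ Finset.Icc (-2 : ℤ) 2).erase 0

/-- **Exact near field** (kernel evaluation over `ℚ`): `Σ_{0<|n|_∞≤2} T = −75.86… < −758/10`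
(two vertical bonds `2V′(h₀)/h₀ = −130.19`, six in-plane `+56.08`, the rest `−1.75`). [folklore] -/
theorem near_sum_lt : (∑ n ∈ blockFin, TQq (pOf n) (qOf n)) < -758 / 10 := by
  decide +kernel

/-- `pOf` is the squared first coordinate. [folklore] -/
theorem cast_pOf (n : ℤ × ℤ × ℤ) : ((pOf n : ℚ) : ℝ) = (Y₀ n 0) ^ 2 := by
  rw [Y₀_apply_zero]; unfold pOf a2q a₀; push_cast; ring

/-- `qOf` is the squared norm. [folklore] -/
theorem cast_qOf (n : ℤ × ℤ × ℤ) : ((qOf n : ℚ) : ℝ) = ‖Y₀ n‖ ^ 2 := by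
  rw [norm_sq_Y₀]; unfold qOf h2q a2q h₀ a₀ Qf; push_cast; ring

/-- The row function `x ↦ e₁ᵀK(x)e₁` (`0` at the origin). [folklore] -/
def hx (x : E3) : ℝ := if x = 0 then 0 else Hess₀ x ex₁

/-- Labels off the origin are nonzero vectors. [folklore] -/
theorem Y₀_ne_zero {n : ℤ × ℤ × ℤ} (hn : n ≠ 0) : Y₀ n ≠ 0 := fun h =>
  hn (Y₀_injective (h.trans Y₀_zero.symm))

/-- On a label `n ≠ 0` the row function is the cast of the rational value. [folklore] -/
theorem hx_Y₀ {n : ℤ × ℤ × ℤ} (hn : n ≠ 0) : hx (Y₀ n) = ((TQq (pOf n) (qOf n) : ℚ) : ℝ) := by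
  rw [cast_TQq, cast_pOf, cast_qOf, hx, if_neg (Y₀_ne_zero hn), Hess₀_ex₁_eq (Y₀_ne_zero hn)]

/-- The near part of the row function. [folklore] -/
def Tnear (n : ℤ × ℤ × ℤ) : ℝ := if n ∈ blockFin then hx (Y₀ n) else 0

/-- The far part of the row function. [folklore] -/
def Tfar (n : ℤ × ℤ × ℤ) : ℝ := if n = 0 ∨ n ∈ blockFin then 0 else hx (Y₀ n)

/-- Row = near + far. [folklore] -/
theorem hx_eq_add (n : ℤ × ℤ × ℤ) : hx (Y₀ n) = Tnear n + Tfar n := by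
  unfold Tnear Tfar
  by_cases h0 : n = 0
  · subst h0; simp [hx, Y₀_zero, blockFin]
  · by_cases hb : n ∈ blockFin <;> simp [hb, h0]

/-- The near part has `HasSum < −75.8`. [folklore] -/
theorem hasSum_Tnear : ∃ S : ℝ, HasSum Tnear S ∧ S < -758 / 10 := by
  refine ⟨∑ n ∈ blockFin, Tnear n, hasSum_sum_of_ne_finset_zero fun n hn => if_neg hn, ?_⟩
  have he : ∑ n ∈ blockFin, Tnear n = ((∑ n ∈ blockFin, TQq (pOf n) (qOf n) : ℚ) : ℝ) := by
    rw [Rat.cast_sum]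
    refine Finset.sum_congr rfl fun n hn => ?_
    have hn0 : n ≠ 0 := (Finset.mem_erase.1 hn).1
    rw [Tnear, if_pos hn, hx_Y₀ hn0]
  rw [he]
  exact_mod_cast near_sum_lt

end Hagg

end Summit.AtomisticToContinuum.Crystallization.Theorems.UniformPolytypeStabilityNegative

end
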